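import Summits.KontsevichZagierPeriods.KontsevichZagierPeriods.Theses.HurwitzMicroSectors

/-!
# Okada's theorem, step (B): twisted vanishing of `L`-type sums forces the coefficient function to vanish

For `f : ZMod L → ℂ` supported on units: if `Σ_{n ≥ 1} f(t⁻¹ n) n^{-w} = 0` for EVERY unit `t`
(`w ≥ 2`), then `f = 0`. Proof: for each Dirichlet character `χ` mod `L`,
`Σ_t χ(t⁻¹) · Σ_n f(t⁻¹n) n^{-w} = (Σ_u χ(u) f(u)) · L(χ⁻¹, w)` and `L(χ⁻¹, w) ≠ 0` (Euler product,
`re w > 1`), so `Σ_u χ(u) f(u) = 0` for all `χ`; orthogonality of characters gives `f = 0`.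
[Okada 1981; Gun–Murty–Rath 2011, proof of Thm 1]
-/

noncomputable section

open Complex
open scoped BigOperators

namespace Summit.KontsevichZagierPeriods.Theorems.HurwitzMicroSectorsHurwitzSectorComplement.Okada

variable {L : ℕ} [NeZero L]

/-- A function on `ZMod L` is bounded by the sum of the norms of its values. [folklore] -/
theorem norm_apply_le_sum (f : ZMod L → ℂ) (x : ZMod L) : ‖f x‖ ≤ ∑ y : ZMod L, ‖f y‖ :=
  Finset.single_le_sum (f := fun y => ‖f y‖) (fun _ _ => norm_nonneg _) (Finset.mem_univ x)

/-- The twisted coefficient sequences `n ↦ f (c n)` have summable `L`-series terms at `w ≥ 2`. [folklore] -/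
theorem summable_term_twist (w : ℕ) (hw : 2 ≤ w) (f : ZMod L → ℂ) (c : ZMod L) :
    Summable (LSeries.term (fun n : ℕ => f (c * (n : ZMod L))) (w : ℂ)) := by
  refine LSeriesSummable_of_bounded_of_one_lt_re (m := ∑ y : ZMod L, ‖f y‖)
    (fun n _ => norm_apply_le_sum f _) ?_
  simp only [natCast_re, Nat.one_lt_cast]
  omega

/-- Reindexing the unit group: for a unit `m`, `Σ_t χ(t⁻¹) f(t⁻¹ m) = χ(m⁻¹) Σ_u χ(u) f(u)`. [folklore] -/
theorem sum_units_twist_unit (χ : DirichletCharacter ℂ L) (f : ZMod L → ℂ) (m : (ZMod L)ˣ) :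
    ∑ t : (ZMod L)ˣ, χ ((t⁻¹ : (ZMod L)ˣ) : ZMod L) * f ((t⁻¹ : (ZMod L)ˣ) * (m : ZMod L)) =
      χ ((m⁻¹ : (ZMod L)ˣ) : ZMod L) * ∑ u : (ZMod L)ˣ, χ (u : ZMod L) * f u := by
  rw [Finset.mul_sum]
  refine Fintype.sum_equiv ⟨fun t : (ZMod L)ˣ => t⁻¹ * m, fun u => m * u⁻¹, fun t => by group,
    fun u => by group⟩ _ _ fun t => ?_
  show χ ((t⁻¹ : (ZMod L)ˣ) : ZMod L) * f ((t⁻¹ : (ZMod L)ˣ) * (m : ZMod L)) =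
    χ ((m⁻¹ : (ZMod L)ˣ) : ZMod L) * (χ ((t⁻¹ * m : (ZMod L)ˣ) : ZMod L) * f ((t⁻¹ * m : (ZMod L)ˣ) : ZMod L))
  rw [Units.val_mul, ← mul_assoc (χ _), ← map_mul]
  congr 2
  have h1 : ((m⁻¹ : (ZMod L)ˣ) : ZMod L) * (m : ZMod L) = 1 := Units.inv_mul m
  calc ((t⁻¹ : (ZMod L)ˣ) : ZMod L) = ((t⁻¹ : (ZMod L)ˣ) : ZMod L) * (((m⁻¹ : (ZMod L)ˣ) : ZMod L) * (m : ZMod L)) := by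
        rw [h1, mul_one]
    _ = ((m⁻¹ : (ZMod L)ˣ) : ZMod L) * (((t⁻¹ : (ZMod L)ˣ) : ZMod L) * (m : ZMod L)) := by ring

/-- Pointwise: `Σ_t χ(t⁻¹) f(t⁻¹ n) = (Σ_u χ(u) f(u)) · χ⁻¹(n)` for `f` supported on units. [folklore] -/
theorem sum_units_twist (χ : DirichletCharacter ℂ L) (f : ZMod L → ℂ)
    (hf : ∀ x : ZMod L, ¬ IsUnit x → f x = 0) (n : ℕ) :
    ∑ t : (ZMod L)ˣ, χ ((t⁻¹ : (ZMod L)ˣ) : ZMod L) * f ((t⁻¹ : (ZMod L)ˣ) * (n : ZMod L)) =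
      (∑ u : (ZMod L)ˣ, χ (u : ZMod L) * f u) * χ⁻¹ (n : ZMod L) := by
  by_cases hn : IsUnit (n : ZMod L)
  · obtain ⟨m, hm⟩ := hn
    rw [← hm, sum_units_twist_unit, MulChar.inv_apply, Ring.inverse_unit, mul_comm]
  · have h0 : ∀ t : (ZMod L)ˣ, f ((t⁻¹ : (ZMod L)ˣ) * (n : ZMod L)) = 0 := fun t => by
      refine hf _ fun hu => hn ?_
      have : (n : ZMod L) = (t : ZMod L) * (((t⁻¹ : (ZMod L)ˣ) : ZMod L) * (n : ZMod L)) := by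
        rw [← mul_assoc, Units.mul_inv, one_mul]
      rw [this]
      exact (Units.isUnit t).mul hu
    simp only [h0, mul_zero, Finset.sum_const_zero, MulChar.map_nonunit _ hn]

/-- **Character projection of the twisted `L`-series**: for `f` supported on units and `w ≥ 2`,
`Σ_t χ(t⁻¹) · L(f(t⁻¹ ·), w) = (Σ_u χ(u) f(u)) · L(χ⁻¹, w)`. [folklore] -/
theorem sum_char_mul_LSeries_twist (w : ℕ) (hw : 2 ≤ w) (χ : DirichletCharacter ℂ L)
    (f : ZMod L → ℂ) (hf : ∀ x : ZMod L, ¬ IsUnit x → f x = 0) :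
    ∑ t : (ZMod L)ˣ, χ ((t⁻¹ : (ZMod L)ˣ) : ZMod L) *
        LSeries (fun n : ℕ => f ((t⁻¹ : (ZMod L)ˣ) * (n : ZMod L))) w =
      (∑ u : (ZMod L)ˣ, χ (u : ZMod L) * f u) * LSeries (fun n : ℕ => χ⁻¹ (n : ZMod L)) w := by
  simp only [LSeries, ← tsum_mul_left]
  rw [← Summable.tsum_finsetSum (fun t _ => (summable_term_twist w hw f _).mul_left _)]
  refine tsum_congr fun n => ?_
  rcases eq_or_ne n 0 with rfl | hn
  · simp [LSeries.term_zero]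
  · simp only [LSeries.term_of_ne_zero hn, mul_div_assoc', ← Finset.sum_div]
    rw [sum_units_twist χ f hf n]

/-- **Step (B) of Okada's theorem.** If `f : ZMod L → ℂ` vanishes off the units and all the twisted
series `Σ_{n≥1} f(t⁻¹ n) n^{-w}` (`t` a unit, `w ≥ 2`) vanish, then `f = 0`: the character sums
`Σ_u χ(u) f(u)` vanish because `L(χ⁻¹, w) ≠ 0`, and characters separate units.
[cite: GunMurtyRath2011, proof of Thm 1] -/
theorem apply_eq_zero_of_forall_LSeries_twist_eq_zero (w : ℕ) (hw : 2 ≤ w) (f : ZMod L → ℂ)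
    (hf : ∀ x : ZMod L, ¬ IsUnit x → f x = 0)
    (h : ∀ t : (ZMod L)ˣ, LSeries (fun n : ℕ => f ((t⁻¹ : (ZMod L)ˣ) * (n : ZMod L))) w = 0)
    (x : ZMod L) : f x = 0 := by
  by_cases hx : IsUnit x
  swap
  · exact hf x hx
  obtain ⟨a, rfl⟩ := hx
  -- every character sum vanishes
  have hA : ∀ χ : DirichletCharacter ℂ L, ∑ u : (ZMod L)ˣ, χ (u : ZMod L) * f u = 0 := by
    intro χ
    have h1 := sum_char_mul_LSeries_twist w hw χ f hf
    simp only [h, mul_zero, Finset.sum_const_zero] at h1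
    have hL : LSeries (fun n : ℕ => χ⁻¹ (n : ZMod L)) w ≠ 0 :=
      DirichletCharacter.LSeries_ne_zero_of_one_lt_re χ⁻¹ (by
        simp only [natCast_re, Nat.one_lt_cast]; omega)
    exact (mul_eq_zero.mp h1.symm).resolve_right hL
  -- orthogonality
  have hsum : ∑ χ : DirichletCharacter ℂ L, χ (a : ZMod L)⁻¹ * ∑ u : (ZMod L)ˣ, χ (u : ZMod L) * f u = 0 := by
    simp only [hA, mul_zero, Finset.sum_const_zero]
  have hex : ∑ χ : DirichletCharacter ℂ L, χ (a : ZMod L)⁻¹ * ∑ u : (ZMod L)ˣ, χ (u : ZMod L) * f u =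
      ∑ u : (ZMod L)ˣ, f u * ∑ χ : DirichletCharacter ℂ L, χ (a : ZMod L)⁻¹ * χ (u : ZMod L) := by
    simp only [Finset.mul_sum]
    rw [Finset.sum_comm]
    refine Finset.sum_congr rfl fun u _ => Finset.sum_congr rfl fun χ _ => by ring
  rw [hex] at hsum
  have hort : ∀ u : (ZMod L)ˣ, ∑ χ : DirichletCharacter ℂ L, χ (a : ZMod L)⁻¹ * χ (u : ZMod L) =
      if (a : ZMod L) = u then (L.totient : ℂ) else 0 := fun u =>
    DirichletCharacter.sum_char_inv_mul_char_eq ℂ (Units.isUnit a) (u : ZMod L)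
  simp only [hort, mul_ite, mul_zero, Units.val_inj, Finset.sum_ite_eq, Finset.mem_univ,
    if_true] at hsum
  have htot : (L.totient : ℂ) ≠ 0 := by exact_mod_cast (Nat.totient_pos.mpr (NeZero.pos L)).ne'
  exact (mul_eq_zero.mp hsum).resolve_right htot

/-- **Step (B) of Okada's theorem, registered form** (explicit binders): a function on `ZMod L`
vanishing off the units all of whose unit-twisted series `Σ_{n≥1} f(t⁻¹ n) n^{-w}` vanish (`w ≥ 2`)
is identically zero. [cite: GunMurtyRath2011, proof of Thm 1] -/
theorem okada_stepB : ∀ (L : ℕ) [NeZero L] (w : ℕ), 2 ≤ w → ∀ (f : ZMod L → ℂ), (∀ x : ZMod L, ¬ IsUnit x → f x = 0) → (∀ t : (ZMod L)ˣ, LSeries (fun n : ℕ => f (((t⁻¹ : (ZMod L)ˣ) : ZMod L) * (n : ZMod L))) (w : ℂ) = 0) → ∀ x : ZMod L, f x = 0 :=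
  fun _ _ w hw f hf h x => apply_eq_zero_of_forall_LSeries_twist_eq_zero w hw f hf h x

end Summit.KontsevichZagierPeriods.Theorems.HurwitzMicroSectorsHurwitzSectorComplement.Okada

end
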